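import Summits.CriticalPhenomena.PercolationContinuityZ3.Theorems.Transplant.BoxProdZ2FibreReach
import HarnessLib

/-!
# Lemma 9-prod, part A′: the UNIFORM fat radius over finitely many fibre centres and the uniform fat prism sequences
# (BLUEPRINT-I-PHI §1 row "Lemma 9", §2 "order of constants": one cube shape for all contacts)

builds on p205010 (kernel theorem, internal audit signed; external expert review pending) — nothing in this file uses p205010.
Lane `prim-bschramm`, seat `prim-bschramm-p3` (Φ3-prod assembly); helper file (`--supports stmt-CriticalPhenomena-4575 --as helper`).

`BoxProdZ2FibreReach` (p212721) builds, for ONE centre `x`, a fat radius `ψ_x` with rare fibre exits.  The seed kit of a tube level uses a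
single fibre radius `nF` for all contacts, whose cubes are centred at the retracted fibre centres `c(w)`; by quasi-transitivity of `X` these
are carried by automorphisms to finitely many representatives, so the Lemma-9 scales must be uniform over a FINITE set `V₀` of centres.
This file repeats the construction uniformly: `exists_ufatStep` (maximum of the per-centre radii; the exit events decrease in the radius),
`ufatRadius hT V₀` with `ψ(n+1) ≥ ψ n + 1` and, for every `x ∈ V₀`, `P(fibre exit at level n+1 from B_X(x, ψ n) × Λ_n beyond ψ(n+1) - 1)
≤ 2^{-(n+1)}` (`prob_fibReach_ufat_le`); the sequences `ufatSeq hT V₀ x n = B_X(x, ψ n) × Λ_n` with the level axioms (monotone, margin,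
exhausting for connected `X`) and `ufatSeq ⊆ tube`.

[cite: KozmaNitzan2024, §4 Lemma 9 (p. 16) — the ℤ^d model] [cite: GrimmettPercolation1999, §7.2 (7.14)–(7.16)] [cite: MartineauSevero2019, Cor. 2.2]
-/

noncomputable section

open MeasureTheory Filter ProbabilityTheory
open scoped Topology ENNReal

namespace Summit.CriticalPhenomena.PercolationContinuityZ3.Theorems

namespace Transplant

namespace BoxProdZ2

open Literature.Probability.Percolation Literature.Probability.LatticeModels SimpleGraph
open Literature.Barriers.CriticalPhenomena (graphBall graphBall_finite mem_graphBall_self graphBall_mono)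

variable {W : Type} (X : SimpleGraph W) [X.LocallyFinite]

/-- One uniform step: a radius `R` beyond which, for EVERY centre `x ∈ V₀`, the fibre exits at level `n + 1` from `B_X(x, r) × Λ_n` have
probability `≤ 2^{-(n+1)}` (maximum of the per-centre radii; the events decrease in the radius). [folklore] -/
theorem exists_ufatStep [Countable W] {p : unitInterval} (hT : TubeSubcritical X p) (V₀ : Finset W) (r n : ℕ) :
    ∃ R : ℕ, ∀ x ∈ V₀, (bondPercolation (X □ zdGraph 2) p).real
      (⋃ a ∈ ballFin X x r ×ˢ box 2 n, fibReach X x (n + 1) R a) ≤ (1 / 2 : ℝ) ^ (n + 1) := by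
  have h : ∀ x ∈ V₀, ∃ R : ℕ, (bondPercolation (X □ zdGraph 2) p).real
      (⋃ a ∈ ballFin X x r ×ˢ box 2 n, fibReach X x (n + 1) R a) ≤ (1 / 2 : ℝ) ^ (n + 1) := fun x _ => exists_fatStep X hT x r n
  choose! R hR using h
  refine ⟨V₀.sup R, fun x hx => le_trans (measureReal_mono ?_ (measure_ne_top _ _)) (hR x hx)⟩
  exact Set.iUnion₂_mono fun a _ => fibReach_antitone X x (n + 1) a (Finset.le_sup hx)

/-- **The uniform fat radius** `ψ` over the finite set of centres `V₀` (depends on `p` through `TubeSubcritical`): `ψ 0 = 0`,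
`ψ (n+1) = max (ψ n + 1) (R_{n+1} + 1)` with `R_{n+1}` from `exists_ufatStep` for the sources `B_X(x, ψ n) × Λ_n`, `x ∈ V₀`.
[cite: KozmaNitzan2024, §4 p. 16 (Lemma 9: the scale M)] -/
def ufatRadius [Countable W] {p : unitInterval} (hT : TubeSubcritical X p) (V₀ : Finset W) : ℕ → ℕ
  | 0 => 0
  | n + 1 => max (ufatRadius hT V₀ n + 1) (Classical.choose (exists_ufatStep X hT V₀ (ufatRadius hT V₀ n) n) + 1)

/-- The uniform fat radius grows by at least one per level. [folklore] -/
theorem ufatRadius_succ_ge [Countable W] {p : unitInterval} (hT : TubeSubcritical X p) (V₀ : Finset W) (n : ℕ) :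
    ufatRadius X hT V₀ n + 1 ≤ ufatRadius X hT V₀ (n + 1) := by
  change ufatRadius X hT V₀ n + 1 ≤ max _ _
  exact le_max_left _ _

/-- The uniform fat radius is monotone. [folklore] -/
theorem ufatRadius_mono [Countable W] {p : unitInterval} (hT : TubeSubcritical X p) (V₀ : Finset W) : Monotone (ufatRadius X hT V₀) := by
  refine monotone_nat_of_le_succ fun n => ?_
  have := ufatRadius_succ_ge X hT V₀ n; omega

/-- `n ≤ ψ n`. [folklore] -/
theorem le_ufatRadius [Countable W] {p : unitInterval} (hT : TubeSubcritical X p) (V₀ : Finset W) (n : ℕ) : n ≤ ufatRadius X hT V₀ n := by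
  induction n with
  | zero => exact Nat.zero_le _
  | succ n ih => have := ufatRadius_succ_ge X hT V₀ n; omega

/-- **The defining estimate of the uniform fat radius**: for every centre `x ∈ V₀`, fibre exits at level `n + 1` from `B_X(x, ψ n) × Λ_n`
beyond radius `ψ(n+1) - 1` have probability `≤ 2^{-(n+1)}`. [folklore] -/
theorem prob_fibReach_ufat_le [Countable W] {p : unitInterval} (hT : TubeSubcritical X p) {V₀ : Finset W} {x : W} (hx : x ∈ V₀) (n : ℕ) :
    (bondPercolation (X □ zdGraph 2) p).real
      (⋃ a ∈ ballFin X x (ufatRadius X hT V₀ n) ×ˢ box 2 n, fibReach X x (n + 1) (ufatRadius X hT V₀ (n + 1) - 1) a) ≤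
        (1 / 2 : ℝ) ^ (n + 1) := by
  have hspec := Classical.choose_spec (exists_ufatStep X hT V₀ (ufatRadius X hT V₀ n) n) x hx
  set R := Classical.choose (exists_ufatStep X hT V₀ (ufatRadius X hT V₀ n) n) with hR
  have hle : R ≤ ufatRadius X hT V₀ (n + 1) - 1 := by
    have : R + 1 ≤ ufatRadius X hT V₀ (n + 1) := by
      change R + 1 ≤ max _ _; exact le_max_right _ _
    omega
  refine le_trans (measureReal_mono ?_ (measure_ne_top _ _)) hspec
  exact Set.iUnion₂_mono fun a _ => fibReach_antitone X x (n + 1) a hle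

/-- **The uniform fat prism sequence** around the centre `x`: `Λ^fat_n(x) = B_X(x, ψ n) × Λ_n`. [cite: KozmaNitzan2024, §4 p. 16 (Lemma 9)] -/
def ufatSeq [Countable W] {p : unitInterval} (hT : TubeSubcritical X p) (V₀ : Finset W) (x : W) (n : ℕ) : Finset (W × Site 2) :=
  ballFin X x (ufatRadius X hT V₀ n) ×ˢ box 2 n

/-- Membership in a uniform fat prism. [folklore] -/
theorem mem_ufatSeq_iff [Countable W] {p : unitInterval} (hT : TubeSubcritical X p) {V₀ : Finset W} {x : W} {n : ℕ} {v : W × Site 2} :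
    v ∈ ufatSeq X hT V₀ x n ↔ v.1 ∈ ballFin X x (ufatRadius X hT V₀ n) ∧ v.2 ∈ box 2 n := by
  rw [ufatSeq, Finset.mem_product]

/-- The uniform fat prisms increase. [folklore] -/
theorem ufatSeq_monotone [Countable W] {p : unitInterval} (hT : TubeSubcritical X p) (V₀ : Finset W) (x : W) :
    Monotone (ufatSeq X hT V₀ x) := fun _ _ h =>
  Finset.product_subset_product (ballFin_mono X x (ufatRadius_mono X hT V₀ h)) (box_mono 2 h)

/-- **Margin**: the outer boundary of a uniform fat prism lies in the next one. [folklore] -/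
theorem ufatSeq_nest [DecidableEq W] [Countable W] {p : unitInterval} (hT : TubeSubcritical X p) (V₀ : Finset W) (x : W) (n : ℕ) :
    outerBoundary (X □ zdGraph 2) (ufatSeq X hT V₀ x n) ⊆ ufatSeq X hT V₀ x (n + 1) := by
  intro v hv
  have h := outerBoundary_prismBox_subset X x (ufatRadius X hT V₀ n) (-((n : ℕ) : Site 2)) ((n : ℕ) : Site 2)
  rw [ufatSeq, box_eq_Icc] at hv
  have hv' := h (by simpa [prismBox] using hv)
  rw [mem_prismBox_iff] at hv'
  rw [mem_ufatSeq_iff]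
  refine ⟨(mem_ballFin X).2 (graphBall_mono X x (ufatRadius_succ_ge X hT V₀ n) hv'.1), ?_⟩
  rw [box_eq_Icc]
  refine Finset.Icc_subset_Icc (fun i => ?_) (fun i => ?_) hv'.2 <;>
    simp only [Pi.sub_apply, Pi.add_apply, Pi.neg_apply, Pi.natCast_apply, Pi.one_apply] <;> push_cast <;> omega

/-- **Exhaustion**: for connected `X` every vertex of `X □ ℤ²` lies in some uniform fat prism. [folklore] -/
theorem ufatSeq_exhaust [Countable W] {p : unitInterval} (hT : TubeSubcritical X p) (V₀ : Finset W) (hX : X.Connected) (x : W)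
    (v : W × Site 2) : ∃ n, v ∈ ufatSeq X hT V₀ x n := by
  obtain ⟨wk⟩ := hX.preconnected x v.1
  set n : ℕ := wk.length + ∑ i, (v.2 i).natAbs with hn
  refine ⟨n, (mem_ufatSeq_iff X hT).2 ⟨(mem_ballFin X).2 ⟨wk, (by omega : wk.length ≤ n).trans (le_ufatRadius X hT V₀ n)⟩, ?_⟩⟩
  rw [mem_box]
  intro i
  have hi : (v.2 i).natAbs ≤ ∑ j, (v.2 j).natAbs :=
    Finset.single_le_sum (f := fun j => (v.2 j).natAbs) (fun _ _ => Nat.zero_le _) (Finset.mem_univ i)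
  constructor <;> omega

/-- A uniform fat prism of level `n` lies in the tube `X × Λ_n`. [folklore] -/
theorem ufatSeq_subset_tube [Countable W] {p : unitInterval} (hT : TubeSubcritical X p) (V₀ : Finset W) (x : W) (n : ℕ) :
    (↑(ufatSeq X hT V₀ x n) : Set (W × Site 2)) ⊆ tube W n := fun v hv =>
  (mem_tube n v).2 ((mem_ufatSeq_iff X hT).1 (Finset.mem_coe.1 hv)).2

end BoxProdZ2

end Transplant

end Summit.CriticalPhenomena.PercolationContinuityZ3.Theorems

end
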